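import Mathlib
import Literature.MathematicalPhysics.QuantumFieldTheory.Balaban1983to89.B6TorusTransplant

/-!
# `Balaban1983to89.B6TransplantMajorants` — T. Bałaban, *Propagators and renormalization transformations for lattice gauge theories. II*,
Commun. Math. Phys. **96** (1984) 223–250 [Balaban1984PropagatorsII]: **the (2.51)-majorants of the local inverse `G′(□̃)` (the Green's function of
the small torus `T_□̃`, transplanted to the window) and of the commutator product `K(χ_□)G′(□̃)`** — the located inputs `hGw`, `hKGw` of the p. 238
change-of-domain chain `B6Prop23DomainInput.hdom_of_line3` for the GENUINE one-scale operators, with the SAME constants `(δ₀, C, θ₀)` as the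
global `G′` (`B6Commutator244TowerTorus.hasMajorant_comm_G`), because `T_□̃` is itself a member of the one-scale torus family.

statement-level skeleton of published theorems with citation tags; proofs where landed; nothing here is a claim about the Yang–Mills mass gap

Phase-2 PROOF SEAT p01 (gen 8) of the cell `lit-balaban` (HOME `run/shared/lean/pub/lit-balaban/`), free-target protocol G.5-34(d), own lane;
file 5 of the programme «the MODIFIED prescription of (2.70) `C_□ = ((Q′G′(□̃)²Q′*)↾□)⁻¹` with `G′(□̃)` on the torus `T_□̃` and the p. 238
change-of-domain sentence, genuine».  Sources read as page images: `run/shared/lean/pub/pub-balaban/b2b-balaban-ref1/pages/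
1984-cmp96-propagators-rt-II/1984-cmp96-propagators-rt-II-p012-x2.png` (p. 234, (2.64)–(2.67)), `…-p016-x2.png` (p. 238); journal page = PDF page + 222.

THE PRINTED TEXT.  p. 238 [PDF 16], verbatim: *"so for M large enough the norm is small. Similar inequalities hold for kernels of the
other operators forming R, for example the operator with G′(□̃)² − G′² is small and an estimate has the factor e^{−δ₀M} because of the
usual estimate of the type (1.12) [3] connected with a change of a domain. This estimate follows from the random walk representations
(2.50) for the operators G′, G′(□̃)."* (GLOSS, ours, not print: every term of (2.82) p. 237 is estimated by a kernel bound
`O(1)exp(−δ₀ dist(y, y′))`, cf. (2.83)–(2.84) p. 237; this file supplies the (2.67)-type majorants of `G′(□̃)` that such bounds use); (2.67) p. 234: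
*"|G′(y, y′)|, |(∇^ηG′)(y, y′)| … ≤ O(1)exp(−δ₀|y − y′|)"* (Proposition 2.2, for every torus of the family — in particular for `T_□̃`).

WHAT THIS FILE PROVES (kernel-checked, 0 sorry, axioms standard).  `P′ = smallVol P m′`, window corner `c`, core `V` of deep unit blocks of the
window lying within half the small period of each other (`hVhalf`):
* §1 the unit distance grows under the transplant, `|y − y′|₁ ≤ |ι_Ky − ι_Ky′|′₁` on `V` (`T1_le_T1_iotaK`); block support is transplanted
  (`blockSupp_transplant`).
* §2 **`hGw`**: from the (2.67)₁-majorant `C·e^{−½δ₀|z−z′|′₁}` of `G′_{T_□̃}` (the member `P′` of the family), the SAME majorant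
  `C·e^{−½δ₀|y−y′|₁}` for `G′(□̃) = 1_V·J·G′_{T_□̃}·Jᵀ·1_V` on the big torus (`hasMajorant_Gw`).
* §3 the η-gradient of `G′(□̃)f` at sites over `V` is the transplanted gradient (`deriv_Gw_apply`, `deriv_Gw_apply_unshift`) and obeys the
  (2.67)₂-bound of the small torus (`abs_deriv_Gw_le`, `abs_deriv_Gw_unshift_le`).
* §4 **`hKGw`**: the commutator product `(χΔ′_a − Δ′_aχ)·G′(□̃)` has the ZONE majorant `1_N(y)·(θ₀/M)·e^{−½δ₀|y−y′|₁}` with the same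
  `θ₀ = theta0 d a C δ₀` as `hasMajorant_comm_G` (`hasMajorant_comm_Gw`), for a cut-off `χ = chiCut P c_χ H M` whose support, thickened by
  two unit steps, lies over `V` (`hχV`).

HONEST SCOPE ∕ NOT CLAIMED.  `G′(□̃)` with periodic boundary conditions on `□̃` (declared reading, see `…B6TorusTransplant`), cut to `V`;
hypotheses `hV`, `hVhalf`, `hχV` are geometric conditions on the window/core/cut-off discharged where the cubes are instantiated (sibling
(2.70) file).  One scale, scalar model.  Value = the located majorant inputs for the genuine operators, NOT summit progress.
-/

namespace Literature.MathematicalPhysics.QuantumFieldTheory.Balaban1983to89.B6TransplantMajorants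

open Finset Matrix
open B1RG242Torus (tower deriv deriv_mulVec)
open B5Ineq137Torus (blk fine)
open B6Prop22OneScaleTorus (T1 oneScaleGeo)
open B6Lemma21TowerTorus (T1_triangle T1_symm T1_nonneg)
open B6QGGQInvTowerTorus (T1_self)
open B6RandomWalk (HasMajorant BlockSupp)
open B6Expansion282 (mulOp mulOp_apply)
open B6TorusWindowChart
open B10StarCount (shift_unshift unshift_shift)
open B6TorusCutoffChi (chiCut Core)
open B6Commutator244TowerTorus (Dop Gop Gop_apply_eq theta0 theta0_pos abs_comm_apply_le_theta0 comm_apply_eq_zero_of_core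
  comm_apply_eq_zero_of_vanish)
open B6TorusTransplant

noncomputable section

variable {P : Params} {c : Site P P.K} {m' : ℕ} {V : Finset (Site P P.K)} {a msq : ℝ}

/-! ## §1  Distances and block supports under the transplant -/

/-- **the unit distance grows under the transplant**: for unit sites of the window lying (chartwise) within half the small period of each
other, `|y − y′|₁ ≤ |ι_K y − ι_K y′|′₁` (the torus distance of `T₁^{(K)}` is below the chart `ℓ¹`-distance, which IS the torus distance of
`T′₁^{(K)}` under the half-period condition). [cite: Balaban1984PropagatorsII, p.238 («identify it with a torus»); bookkeeping] -/
theorem T1_le_T1_iotaK {y y' : Site P P.K} (hy : InW P c m' y) (hy' : InW P c m' y')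
    (hhalf : ∀ μ, 2 * |(woff P P.K c y μ : ℤ) - (woff P P.K c y' μ : ℤ)| ≤ (smallVol P m').sitesPerDir P.K) :
    T1 P P.K y y' ≤ T1 (smallVol P m') P.K (iotaK P c m' y) (iotaK P c m' y') := by
  have h1 := T1_le_sum_abs_woff P.K c y y'
  have h2 := T1_eq_sum_abs_woff (P := smallVol P m') P.K (origin (smallVol P m') P.K) (iotaK P c m' y) (iotaK P c m' y')
    fun μ => by rw [woff_iotaK hy, woff_iotaK hy']; exact hhalf μ
  rw [h2]
  refine h1.trans (le_of_eq (Finset.sum_congr rfl fun μ _ => ?_))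
  rw [woff_iotaK hy, woff_iotaK hy']

/-- **block support is transplanted**: for `f` supported in the block `y′` with bound `B`, the pulled-back `Jᵀ(1_Vf)` is supported in the
block `ι_K y′` of `T_□̃` with the same bound. [cite: Balaban1984PropagatorsII, (2.51) p.232; bookkeeping] -/
theorem blockSupp_transplant (hm : m' ≤ P.m) {Mb R Mb' R' : ℕ} {f : Site P 0 → ℝ} {y' : Site P P.K} {B : ℝ}
    (hf : BlockSupp (g := oneScaleGeo P Mb R) (blk P P.K) f y' B) :
    BlockSupp (g := oneScaleGeo (smallVol P m') Mb' R') (blk (smallVol P m') P.K)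
      ((Jmat P c m')ᵀ *ᵥ (Matrix.diagonal (indV P V) *ᵥ f)) (iotaK P c m' y') B := by
  have hblk : ∀ z, f (kap0 P c m' z) ≠ 0 → blk (smallVol P m') P.K z = iotaK P c m' y' := by
    intro z hz
    have hb : blk P P.K (kap0 P c m' z) = y' := by_contra fun hne => hz (hf.off _ hne)
    rw [← iota0_kap0 (c := c) hm z, blk_iota0 (inW0_kap0 hm z), hb]
  refine ⟨hf.nonneg, fun z _ => ?_, fun z hz => ?_⟩
  · rw [Jt_indV_mulVec]
    by_cases h0 : f (kap0 P c m' z) = 0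
    · rw [h0, mul_zero, abs_zero]; exact hf.nonneg
    · have hb : blk P P.K (kap0 P c m' z) = y' := by_contra fun hne => h0 (hf.off _ hne)
      rw [abs_mul]
      calc |indV P V (kap0 P c m' z)| * |f (kap0 P c m' z)| ≤ 1 * |f (kap0 P c m' z)| := by
            gcongr
            unfold indV; split_ifs <;> simp
        _ ≤ B := by rw [one_mul]; exact hf.bound _ hb
  · rw [Jt_indV_mulVec]
    by_contra hne
    have h0 : f (kap0 P c m' z) ≠ 0 := fun h => hne (by rw [h, mul_zero])
    exact hz (hblk z h0)

/-- if the source block is not over `V` the pulled-back function vanishes. [cite: Balaban1984PropagatorsII, (2.51) p.232; bookkeeping] -/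
theorem Jt_indV_eq_zero_of_not_mem {Mb R : ℕ} {f : Site P 0 → ℝ} {y' : Site P P.K} {B : ℝ}
    (hf : BlockSupp (g := oneScaleGeo P Mb R) (blk P P.K) f y' B) (hy' : y' ∉ V) :
    (Jmat P c m')ᵀ *ᵥ (Matrix.diagonal (indV P V) *ᵥ f) = 0 := by
  funext z
  rw [Jt_indV_mulVec, Pi.zero_apply]
  by_cases h0 : f (kap0 P c m' z) = 0
  · rw [h0, mul_zero]
  · have hb : blk P P.K (kap0 P c m' z) = y' := by_contra fun hne => h0 (hf.off _ hne)
    rw [indV_of_not_mem fun hmem => hy' (hb ▸ hmem), zero_mul]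

/-! ## §2  `hGw`: the majorant of `G′(□̃)` -/

/-- **`hGw` — THE (2.67)₁-MAJORANT OF THE LOCAL INVERSE**: if `G′_{T_□̃}` has the 𝔅′-majorant `C·e^{−½δ₀|z−z′|′₁}` (Prop. 2.2 for the member
`P′` of the family), then `G′(□̃) = 1_V·J·G′_{T_□̃}·Jᵀ·1_V` has the 𝔅-majorant `C·e^{−½δ₀|y−y′|₁}` — same `C`, same `δ₀`.
[cite: Balaban1984PropagatorsII, (2.67) p.234, p.238 («we can prove exactly the same way …»)] -/
theorem hasMajorant_Gw (hm : m' ≤ P.m) (hV : ∀ y ∈ V, DeepBlk P c m' y)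
    (hVhalf : ∀ y ∈ V, ∀ y' ∈ V, ∀ μ,
      2 * |(woff P P.K c y μ : ℤ) - (woff P P.K c y' μ : ℤ)| ≤ (smallVol P m').sitesPerDir P.K)
    {Mb R Mb' R' : ℕ} {C δ₀ : ℝ} (hC : 0 ≤ C) (hδ₀ : 0 ≤ δ₀)
    (hG' : HasMajorant (g := oneScaleGeo (smallVol P m') Mb' R') (blk (smallVol P m') P.K) (Gop (smallVol P m') a msq)
      (fun z z' => C * Real.exp (-(δ₀ / 2 * T1 (smallVol P m') P.K z z')))) :
    HasMajorant (g := oneScaleGeo P Mb R) (blk P P.K) (Gw P c m' V a msq)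
      (fun y y' => C * Real.exp (-(δ₀ / 2 * T1 P P.K y y'))) := by
  intro y' f B hf x
  beta_reduce
  have hB := hf.nonneg
  rw [Gw_apply_eq, GwMat_mulVec hm hV]
  by_cases hxV : blk P P.K x ∈ V
  · by_cases hy' : y' ∈ V
    · rw [indV_of_mem hxV, one_mul, ← Gop_apply_eq]
      have hx0 : InW0 P c m' x := (inW0_iff_inW x).mpr (inW_of_deepBlk (hV _ hxV))
      have h := hG' (iotaK P c m' y') _ B (blockSupp_transplant (V := V) hm hf) (iota0 P c m' x)
      beta_reduce at h
      rw [blk_iota0 hx0] at h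
      refine h.trans ?_
      have hT := T1_le_T1_iotaK (inW_of_deepBlk (hV _ hxV)) (inW_of_deepBlk (hV _ hy')) (hVhalf _ hxV _ hy')
      have hexp : Real.exp (-(δ₀ / 2 * T1 (smallVol P m') P.K (iotaK P c m' (blk P P.K x)) (iotaK P c m' y'))) ≤
          Real.exp (-(δ₀ / 2 * T1 P P.K (blk P P.K x) y')) :=
        Real.exp_le_exp.mpr (neg_le_neg (mul_le_mul_of_nonneg_left hT (by positivity)))
      exact mul_le_mul_of_nonneg_right (mul_le_mul_of_nonneg_left hexp hC) hB
    · rw [Jt_indV_eq_zero_of_not_mem hf hy', Matrix.mulVec_zero, Pi.zero_apply, mul_zero, abs_zero]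
      positivity
  · rw [indV_of_not_mem hxV, zero_mul, abs_zero]
    positivity

/-! ## §3  The η-gradient of `G′(□̃)f` over `V` -/

/-- at a site whose block and forward-neighbour block lie over `V`: `(∂^η_μ G′(□̃)f)(x) = ((∂′^η_μ G′_{T_□̃})(Jᵀ1_Vf))(ι₀x)`.
[cite: Balaban1984PropagatorsII, (2.67) p.234, p.238; bookkeeping] -/
theorem deriv_Gw_apply (hm : m' ≤ P.m) (hV : ∀ y ∈ V, DeepBlk P c m' y) (f : Site P 0 → ℝ) {x : Site P 0} (μ : Fin P.d)
    (hx : blk P P.K x ∈ V) (hxs : blk P P.K (x.shift μ) ∈ V) :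
    (deriv P 0 P.eps μ *ᵥ (GwMat P c m' V a msq *ᵥ f)) x =
      ((deriv (smallVol P m') 0 (smallVol P m').eps μ * (tower (smallVol P m') a msq).G (smallVol P m').K) *ᵥ
        ((Jmat P c m')ᵀ *ᵥ (Matrix.diagonal (indV P V) *ᵥ f))) (iota0 P c m' x) := by
  obtain ⟨_, h2⟩ := woff_bounds_of_deepBlk (hV _ hx) μ
  rw [deriv_mulVec, GwMat_mulVec hm hV, GwMat_mulVec hm hV, indV_of_mem hx, indV_of_mem hxs, one_mul, one_mul,
    iota0_shift μ (by omega) hm, ← Matrix.mulVec_mulVec, deriv_mulVec]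
  rfl

/-- at a site whose block and backward-neighbour block lie over `V`: `(∂^η_μ G′(□̃)f)(x − e_μ) = ((∂′^η_μ G′_{T_□̃})(Jᵀ1_Vf))(ι₀x − e_μ)`.
[cite: Balaban1984PropagatorsII, (2.67) p.234, p.238; bookkeeping] -/
theorem deriv_Gw_apply_unshift (hm : m' ≤ P.m) (hV : ∀ y ∈ V, DeepBlk P c m' y) (f : Site P 0 → ℝ) {x : Site P 0}
    (μ : Fin P.d) (hx : blk P P.K x ∈ V) (hxu : blk P P.K (x.unshift μ) ∈ V) :
    (deriv P 0 P.eps μ *ᵥ (GwMat P c m' V a msq *ᵥ f)) (x.unshift μ) =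
      ((deriv (smallVol P m') 0 (smallVol P m').eps μ * (tower (smallVol P m') a msq).G (smallVol P m').K) *ᵥ
        ((Jmat P c m')ᵀ *ᵥ (Matrix.diagonal (indV P V) *ᵥ f))) ((iota0 P c m' x).unshift μ) := by
  obtain ⟨h1, _⟩ := woff_bounds_of_deepBlk (hV _ hx) μ
  rw [deriv_mulVec, shift_unshift, GwMat_mulVec hm hV, GwMat_mulVec hm hV, indV_of_mem hx, indV_of_mem hxu, one_mul,
    one_mul, iota0_unshift μ h1, ← Matrix.mulVec_mulVec, deriv_mulVec, shift_unshift]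
  rfl

/-- **the (2.67)₂-bound for `∂^ηG′(□̃)` at `x`** (blocks of `x`, `x + e_μ` over `V`): `|(∂^η_μG′(□̃)f)(x)| ≤ Ce^{−½δ₀|blk x − y′|₁}B`.
[cite: Balaban1984PropagatorsII, (2.67) p.234, p.238] -/
theorem abs_deriv_Gw_le (hm : m' ≤ P.m) (hV : ∀ y ∈ V, DeepBlk P c m' y)
    (hVhalf : ∀ y ∈ V, ∀ y' ∈ V, ∀ μ,
      2 * |(woff P P.K c y μ : ℤ) - (woff P P.K c y' μ : ℤ)| ≤ (smallVol P m').sitesPerDir P.K)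
    {Mb R Mb' R' : ℕ} {C δ₀ : ℝ} (hC : 0 ≤ C) (hδ₀ : 0 ≤ δ₀)
    (hdG' : ∀ (μ : Fin P.d) (z' : Site (smallVol P m') P.K) (g : Site (smallVol P m') 0 → ℝ) (B : ℝ),
      BlockSupp (g := oneScaleGeo (smallVol P m') Mb' R') (blk (smallVol P m') P.K) g z' B →
        ∀ z, |((deriv (smallVol P m') 0 (smallVol P m').eps μ * (tower (smallVol P m') a msq).G (smallVol P m').K) *ᵥ g) z| ≤
          C * Real.exp (-(δ₀ / 2 * T1 (smallVol P m') P.K (blk (smallVol P m') P.K z) z')) * B)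
    {f : Site P 0 → ℝ} {y' : Site P P.K} {B : ℝ} (hf : BlockSupp (g := oneScaleGeo P Mb R) (blk P P.K) f y' B)
    {x : Site P 0} (μ : Fin P.d) (hx : blk P P.K x ∈ V) (hxs : blk P P.K (x.shift μ) ∈ V) :
    |(deriv P 0 P.eps μ *ᵥ (GwMat P c m' V a msq *ᵥ f)) x| ≤ C * Real.exp (-(δ₀ / 2 * T1 P P.K (blk P P.K x) y')) * B := by
  have hB := hf.nonneg
  rw [deriv_Gw_apply hm hV f μ hx hxs]
  by_cases hy' : y' ∈ V
  · have hx0 : InW0 P c m' x := (inW0_iff_inW x).mpr (inW_of_deepBlk (hV _ hx))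
    have h := hdG' μ (iotaK P c m' y') _ B (blockSupp_transplant (V := V) hm hf) (iota0 P c m' x)
    rw [blk_iota0 hx0] at h
    refine h.trans ?_
    have hT := T1_le_T1_iotaK (inW_of_deepBlk (hV _ hx)) (inW_of_deepBlk (hV _ hy')) (hVhalf _ hx _ hy')
    have hexp : Real.exp (-(δ₀ / 2 * T1 (smallVol P m') P.K (iotaK P c m' (blk P P.K x)) (iotaK P c m' y'))) ≤
        Real.exp (-(δ₀ / 2 * T1 P P.K (blk P P.K x) y')) :=
      Real.exp_le_exp.mpr (neg_le_neg (mul_le_mul_of_nonneg_left hT (by positivity)))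
    exact mul_le_mul_of_nonneg_right (mul_le_mul_of_nonneg_left hexp hC) hB
  · rw [Jt_indV_eq_zero_of_not_mem hf hy', Matrix.mulVec_zero, Pi.zero_apply, abs_zero]
    positivity

/-- **the (2.67)₂-bound for `∂^ηG′(□̃)` at `x − e_μ`** (blocks of `x`, `x − e_μ` over `V`), with the neighbouring-block factor `e^{δ₀/2}`:
`|(∂^η_μG′(□̃)f)(x − e_μ)| ≤ Ce^{δ₀/2}e^{−½δ₀|blk x − y′|₁}B`. [cite: Balaban1984PropagatorsII, (2.67) p.234, p.238] -/
theorem abs_deriv_Gw_unshift_le (hm : m' ≤ P.m) (hV : ∀ y ∈ V, DeepBlk P c m' y)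
    (hVhalf : ∀ y ∈ V, ∀ y' ∈ V, ∀ μ,
      2 * |(woff P P.K c y μ : ℤ) - (woff P P.K c y' μ : ℤ)| ≤ (smallVol P m').sitesPerDir P.K)
    {Mb R Mb' R' : ℕ} {C δ₀ : ℝ} (hC : 0 ≤ C) (hδ₀ : 0 ≤ δ₀)
    (hdG' : ∀ (μ : Fin P.d) (z' : Site (smallVol P m') P.K) (g : Site (smallVol P m') 0 → ℝ) (B : ℝ),
      BlockSupp (g := oneScaleGeo (smallVol P m') Mb' R') (blk (smallVol P m') P.K) g z' B →
        ∀ z, |((deriv (smallVol P m') 0 (smallVol P m').eps μ * (tower (smallVol P m') a msq).G (smallVol P m').K) *ᵥ g) z| ≤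
          C * Real.exp (-(δ₀ / 2 * T1 (smallVol P m') P.K (blk (smallVol P m') P.K z) z')) * B)
    {f : Site P 0 → ℝ} {y' : Site P P.K} {B : ℝ} (hf : BlockSupp (g := oneScaleGeo P Mb R) (blk P P.K) f y' B)
    {x : Site P 0} (μ : Fin P.d) (hx : blk P P.K x ∈ V) (hxu : blk P P.K (x.unshift μ) ∈ V) :
    |(deriv P 0 P.eps μ *ᵥ (GwMat P c m' V a msq *ᵥ f)) (x.unshift μ)| ≤
      C * Real.exp (δ₀ / 2) * Real.exp (-(δ₀ / 2 * T1 P P.K (blk P P.K x) y')) * B := by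
  have hB := hf.nonneg
  rw [deriv_Gw_apply_unshift hm hV f μ hx hxu]
  by_cases hy' : y' ∈ V
  · obtain ⟨h1, _⟩ := woff_bounds_of_deepBlk (hV _ hx) μ
    have hx0 : InW0 P c m' x := (inW0_iff_inW x).mpr (inW_of_deepBlk (hV _ hx))
    have hxu0 : InW0 P c m' (x.unshift μ) := inW0_unshift hx0 μ h1
    have h := hdG' μ (iotaK P c m' y') _ B (blockSupp_transplant (V := V) hm hf) ((iota0 P c m' x).unshift μ)
    rw [← iota0_unshift μ h1] at h ⊢
    rw [blk_iota0 hxu0] at h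
    refine h.trans ?_
    have hT := T1_le_T1_iotaK (inW_of_deepBlk (hV _ hxu)) (inW_of_deepBlk (hV _ hy')) (hVhalf _ hxu _ hy')
    have hexp : Real.exp (-(δ₀ / 2 * T1 (smallVol P m') P.K (iotaK P c m' (blk P P.K (x.unshift μ))) (iotaK P c m' y'))) ≤
        Real.exp (-(δ₀ / 2 * T1 P P.K (blk P P.K (x.unshift μ)) y')) :=
      Real.exp_le_exp.mpr (neg_le_neg (mul_le_mul_of_nonneg_left hT (by positivity)))
    have hnb := exp_T1_unshift_le (δ := δ₀ / 2) (by positivity) x μ y'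
    calc C * Real.exp (-(δ₀ / 2 * T1 (smallVol P m') P.K (iotaK P c m' (blk P P.K (x.unshift μ))) (iotaK P c m' y'))) * B
        ≤ C * (Real.exp (δ₀ / 2) * Real.exp (-(δ₀ / 2 * T1 P P.K (blk P P.K x) y'))) * B := by
          gcongr
          exact hexp.trans hnb
      _ = C * Real.exp (δ₀ / 2) * Real.exp (-(δ₀ / 2 * T1 P P.K (blk P P.K x) y')) * B := by ring
  · rw [Jt_indV_eq_zero_of_not_mem hf hy', Matrix.mulVec_zero, Pi.zero_apply, abs_zero]
    positivity

/-! ## §4  `hKGw`: the zone majorant of `K(χ)G′(□̃)` -/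

/-- **`hKGw` — THE ZONE MAJORANT OF THE COMMUTATOR PRODUCT WITH THE LOCAL INVERSE**: for a cut-off `χ = chiCut P c_χ H M` whose support,
thickened by two unit steps, lies over the core `V` (`hχV`), and the (2.67) majorants of `G′_{T_□̃}` (member `P′` of the family), the product
`(χΔ′_a − Δ′_aχ)·G′(□̃)` has the majorant `1_N(y)·(θ₀/M)·e^{−½δ₀|y−y′|₁}`, `θ₀ = theta0 d a C δ₀`, `N` = the complement of the core of the
chart — the same bound, same constant, as for the global `G′` (`B6Commutator244TowerTorus.hasMajorant_comm_G`).
[cite: Balaban1984PropagatorsII, (2.44) p.230, (2.67) p.234, p.238 («exactly the same way»)] -/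
theorem hasMajorant_comm_Gw {d : ℕ} (hPd : P.d = d) (ha : 0 < a) (hK : 1 ≤ P.K) (hm : m' ≤ P.m)
    (hV : ∀ y ∈ V, DeepBlk P c m' y)
    (hVhalf : ∀ y ∈ V, ∀ y' ∈ V, ∀ μ,
      2 * |(woff P P.K c y μ : ℤ) - (woff P P.K c y' μ : ℤ)| ≤ (smallVol P m').sitesPerDir P.K)
    {cχ : Site P P.K} {H M : ℕ} (hM : 1 ≤ M) (hH : 7 * M + 4 ≤ 4 * H) (hN : 4 * H + 7 * M + 8 ≤ 4 * P.sitesPerDir P.K)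
    (hχV : ∀ x'', chiCut P cχ H M x'' ≠ 0 → ∀ y, T1 P P.K (blk P P.K x'') y ≤ 2 → y ∈ V)
    {Mb R Mb' R' : ℕ} {C δ₀ : ℝ} (hC : 0 < C) (hδ₀ : 0 < δ₀)
    (hG' : HasMajorant (g := oneScaleGeo (smallVol P m') Mb' R') (blk (smallVol P m') P.K) (Gop (smallVol P m') a msq)
      (fun z z' => C * Real.exp (-(δ₀ / 2 * T1 (smallVol P m') P.K z z'))))
    (hdG' : ∀ (μ : Fin P.d) (z' : Site (smallVol P m') P.K) (g : Site (smallVol P m') 0 → ℝ) (B : ℝ),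
      BlockSupp (g := oneScaleGeo (smallVol P m') Mb' R') (blk (smallVol P m') P.K) g z' B →
        ∀ z, |((deriv (smallVol P m') 0 (smallVol P m').eps μ * (tower (smallVol P m') a msq).G (smallVol P m').K) *ᵥ g) z| ≤
          C * Real.exp (-(δ₀ / 2 * T1 (smallVol P m') P.K (blk (smallVol P m') P.K z) z')) * B) :
    HasMajorant (g := oneScaleGeo P Mb R) (blk P P.K)
      ((mulOp (chiCut P cχ H M) * Dop P a msq - Dop P a msq * mulOp (chiCut P cχ H M)) * Gw P c m' V a msq)
      (fun y y' => (if y ∈ Finset.univ \ Core P cχ H M then theta0 d a C δ₀ / M else 0) *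
        Real.exp (-(δ₀ / 2 * T1 P P.K y y'))) := by
  intro y' f B hf x
  beta_reduce
  have hB : 0 ≤ B := hf.nonneg
  have hθ := theta0_pos d ha.le hC.le δ₀
  have hnn : 0 ≤ (if blk P P.K x ∈ Finset.univ \ Core P cχ H M then theta0 d a C δ₀ / M else 0) := by
    split_ifs <;> positivity
  rw [Module.End.mul_apply]
  by_cases hx : blk P P.K x ∈ Core P cχ H M
  · rw [comm_apply_eq_zero_of_core hM hH hN _ hx, abs_zero]; positivity
  have hxN : blk P P.K x ∈ Finset.univ \ Core P cχ H M := Finset.mem_sdiff.mpr ⟨Finset.mem_univ _, hx⟩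
  rw [if_pos hxN]
  by_cases hex : ∃ x'', chiCut P cχ H M x'' ≠ 0 ∧ T1 P P.K (blk P P.K x'') (blk P P.K x) ≤ 1
  · obtain ⟨x'', hx'', hT⟩ := hex
    -- the blocks of `x` and of its neighbours are over `V`
    have hxV : blk P P.K x ∈ V := hχV x'' hx'' _ (hT.trans (by norm_num))
    have hsV : ∀ μ, blk P P.K (x.shift μ) ∈ V ∧ blk P P.K (x.unshift μ) ∈ V := by
      intro μ
      constructor
      · refine hχV x'' hx'' _ ?_
        have := T1_triangle P P.K (blk P P.K x'') (blk P P.K x) (blk P P.K (x.shift μ))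
        have := T1_blk_shift_le x μ
        linarith
      · refine hχV x'' hx'' _ ?_
        have := T1_triangle P P.K (blk P P.K x'') (blk P P.K x) (blk P P.K (x.unshift μ))
        have := T1_blk_unshift_le x μ
        linarith
    set E := Real.exp (-(δ₀ / 2 * T1 P P.K (blk P P.K x) y')) with hE
    have hexp1 : (1 : ℝ) ≤ Real.exp (δ₀ / 2) := Real.one_le_exp (by positivity)
    have hGw := hasMajorant_Gw (a := a) (msq := msq) (Mb := Mb) (R := R) hm hV hVhalf hC.le hδ₀.le hG'
    have hA : ∀ x', blk P P.K x' = blk P P.K x → |Gw P c m' V a msq f x'| ≤ C * Real.exp (δ₀ / 2) * E * B := by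
      intro x' hx'
      have h0 := hGw y' f B hf x'
      beta_reduce at h0
      rw [hx'] at h0
      calc |Gw P c m' V a msq f x'| ≤ C * E * B := h0
        _ ≤ C * Real.exp (δ₀ / 2) * E * B := by
            have : C * E * B = C * 1 * E * B := by ring
            rw [this]; gcongr
    have hA' : ∀ μ, |(deriv P 0 P.eps μ *ᵥ Gw P c m' V a msq f) x| ≤ C * Real.exp (δ₀ / 2) * E * B ∧
        |(deriv P 0 P.eps μ *ᵥ Gw P c m' V a msq f) (x.unshift μ)| ≤ C * Real.exp (δ₀ / 2) * E * B := by
      intro μ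
      rw [Gw_apply_eq]
      constructor
      · calc |(deriv P 0 P.eps μ *ᵥ (GwMat P c m' V a msq *ᵥ f)) x| ≤ C * E * B :=
            abs_deriv_Gw_le hm hV hVhalf hC.le hδ₀.le hdG' hf μ hxV (hsV μ).1
          _ ≤ C * Real.exp (δ₀ / 2) * E * B := by
              have : C * E * B = C * 1 * E * B := by ring
              rw [this]; gcongr
      · exact abs_deriv_Gw_unshift_le hm hV hVhalf hC.le hδ₀.le hdG' hf μ hxV (hsV μ).2
    exact abs_comm_apply_le_theta0 (msq := msq) (c := cχ) hPd ha hK hM hH hN (Gw P c m' V a msq f) x hC.le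
      (by positivity) hB hA hA'
  · -- `χ` vanishes on the block of `x` and at its nearest neighbours: the commutator vanishes at `x`
    have hvan : ∀ x'', T1 P P.K (blk P P.K x'') (blk P P.K x) ≤ 1 → chiCut P cχ H M x'' = 0 := fun x'' hT => by
      by_contra hne; exact hex ⟨x'', hne, hT⟩
    rw [comm_apply_eq_zero_of_vanish a msq (Gw P c m' V a msq f)
      (fun x' hx' => hvan x' (by rw [hx', T1_self]; norm_num))
      (fun μ => ⟨hvan _ (by rw [T1_symm]; exact T1_blk_shift_le x μ),
        hvan _ (by rw [T1_symm]; exact T1_blk_unshift_le x μ)⟩), abs_zero]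
    positivity

end

end Literature.MathematicalPhysics.QuantumFieldTheory.Balaban1983to89.B6TransplantMajorants
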